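import Summits.QuantumFields.GaugeBoot.TiltedBoxRedLinkGeometry
import Summits.QuantumFields.GaugeBoot.PeriodicPairPeel
import HarnessLib

/-!
# The reduced half of the link mirror of the odd square tilted box: standing and hanging plaquettes (gauge-boot, L3 supplement: reduced-half in-plane mirrors, 5a/7)

HONEST FRAMING (cell `pub-gaugeboot`, page 1 of every file): the venture produces certified bounds
on lattice expectations at stated coupling, gauge group, dimension and torus size; NOT a mass gap,
NOT a continuum limit, NOT a string tension; NOT Yang–Mills-summit-bearing (barriers
`FixedCouplingUltralocality`, `PerturbativeInvisibility`). This module is bookkeeping for a small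
structural NEGATIVE result (the REDUCED-half in-plane mirrors of the square tilted boxes are not of
positive type in `d ≥ 3` at small coupling); it discharges nothing by itself.

## Content (odd box `ℤ^d/Γ(2P+1, 2P+1, L)`, `P ≥ 2`, link mirror `Θ_i`, rest set of `TiltedBoxRedLinkGeometry.lean`)

The covering combinatorics behind the order-`β⁸` tube through the free layer `x_i ≡ P + 1`:

* `stdDir q m` — the direction pair `{i, m}` (junk value `q` for `m = i`, never used);
  `stand q ℓ = (z; {i, m})` — the STANDING rest plaquette on the link `ℓ = (z, m)` of the layer
  `P`; `hang q ℓ = (w - e_i; {i, m})` — the HANGING rest plaquette under the link `ℓ = (w, m)`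
  of the layer `P + 2`; their links (`hasLink_stand_iff`, `hasLink_hang_iff`);
* ★ **`eq_stand_of_isRest`** / **`eq_hang_of_isRest`** — UNIQUENESS: a rest plaquette containing a
  transverse link (direction `≠ i`) of the layer `P` (resp. `P + 2`) IS the standing (resp.
  hanging) plaquette of that link (the other candidates are based in the layers `P - 1`,
  resp. `P + 2`, which are not rest layers for `P ≥ 2`);
* `hasLink_transverse_axisCoord` — the four links of a transverse plaquette `(x; q)`
  (`q₁, q₂ ≠ i`) lie in the layer of `x` and have directions `≠ i`;
* injectivity of `stand`, `hang` on transverse links and `stand ≠ hang` across the layers.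

Pure combinatorics of the box; no integral. The tube and the vanishing of the far pair terms follow
in `TiltedBoxRedLinkTube.lean`.
-/

noncomputable section

open QuotientAddGroup Finset Function

namespace Summit.QuantumFields.GaugeBoot

namespace TiltedRP

namespace RedLink

variable {d : ℕ} {i j : Fin d} {L P : ℕ} [NeZero L] [NeZero P] (q : DirPair d)

/-! ## Layer arithmetic -/

omit [NeZero L] in
/-- `x_i(x + e_i)` as a natural number, one layer up (no wrap below the top). [folklore] -/
theorem val_axisCoord_add_self (x : TiltedSite d i j (2 * P + 1) (2 * P + 1) L)
    (hx : (axisCoord d L (2 * P + 1) x).val + 1 ≤ 2 * P) :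
    (axisCoord d L (2 * P + 1) (x + tiltedUnit d i j (2 * P + 1) (2 * P + 1) L i)).val = (axisCoord d L (2 * P + 1) x).val + 1 := by
  rw [val_axisCoord_add_tiltedUnit_odd x i hx, if_pos rfl]

omit [NeZero L] [NeZero P] in
/-- `x_i(x + e_m) = x_i(x)` for `m ≠ i`. [folklore] -/
theorem axisCoord_add_of_ne (x : TiltedSite d i j (2 * P + 1) (2 * P + 1) L) {m : Fin d} (hm : m ≠ i) :
    axisCoord d L (2 * P + 1) (x + tiltedUnit d i j (2 * P + 1) (2 * P + 1) L m) = axisCoord d L (2 * P + 1) x := by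
  rw [axisCoord_add_tiltedUnit, if_neg hm, add_zero]

omit [NeZero L] in
/-- `x_i(x - e_i) + 1 = x_i(x)` as natural numbers when `x_i(x) ≠ 0`. [folklore] -/
theorem val_axisCoord_sub_self (x : TiltedSite d i j (2 * P + 1) (2 * P + 1) L)
    (hx : (axisCoord d L (2 * P + 1) x).val ≠ 0) :
    (axisCoord d L (2 * P + 1) (x - tiltedUnit d i j (2 * P + 1) (2 * P + 1) L i)).val + 1 = (axisCoord d L (2 * P + 1) x).val := by
  have hsub : axisCoord d L (2 * P + 1) (x - tiltedUnit d i j (2 * P + 1) (2 * P + 1) L i) + 1 = axisCoord d L (2 * P + 1) x := by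
    rw [map_sub, axisCoord_tiltedUnit_self, sub_add_cancel]
  have key := TwoDim.val_add_one_eq (axisCoord d L (2 * P + 1) (x - tiltedUnit d i j (2 * P + 1) (2 * P + 1) L i))
  rw [hsub] at key
  by_cases h : (axisCoord d L (2 * P + 1) (x - tiltedUnit d i j (2 * P + 1) (2 * P + 1) L i)).val = 2 * P
  · rw [if_pos h] at key; exact absurd key hx
  · rw [if_neg h] at key; rw [key]

/-! ## The direction pair `{i, m}` and the standing / hanging plaquettes -/

/-- The direction pair `{i, m}` as a `DirPair` (for `m = i`, which never occurs below, the junk value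
`q`). [folklore] -/
def stdDir (i : Fin d) (m : Fin d) : DirPair d :=
  if h : i < m then ⟨(i, m), h⟩ else if h' : m < i then ⟨(m, i), h'⟩ else q

omit [NeZero L] [NeZero P] in
/-- `stdDir` contains `i` (`m ≠ i`). [folklore] -/
theorem stdDir_hasDir {m : Fin d} (hm : m ≠ i) : (stdDir q i m).1.1 = i ∨ (stdDir q i m).1.2 = i := by
  unfold stdDir
  by_cases h : i < m
  · rw [dif_pos h]; exact Or.inl rfl
  · rw [dif_neg h, dif_pos (lt_of_le_of_ne (not_lt.1 h) hm)]; exact Or.inr rfl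

omit [NeZero L] [NeZero P] in
/-- `stdDir` is injective in `m ≠ i`. [folklore] -/
theorem stdDir_injective {m m' : Fin d} (hm : m ≠ i) (hm' : m' ≠ i) (h : stdDir q i m = stdDir q i m') : m = m' := by
  unfold stdDir at h
  by_cases h1 : i < m <;> by_cases h2 : i < m'
  · rw [dif_pos h1, dif_pos h2] at h; exact (Prod.mk.inj (congrArg Subtype.val h)).2
  · rw [dif_pos h1, dif_neg h2, dif_pos (lt_of_le_of_ne (not_lt.1 h2) hm')] at h
    have := (Prod.mk.inj (congrArg Subtype.val h)).1; exact absurd this.symm hm'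
  · rw [dif_neg h1, dif_pos (lt_of_le_of_ne (not_lt.1 h1) hm), dif_pos h2] at h
    have := (Prod.mk.inj (congrArg Subtype.val h)).1; exact absurd this hm
  · rw [dif_neg h1, dif_pos (lt_of_le_of_ne (not_lt.1 h1) hm), dif_neg h2,
      dif_pos (lt_of_le_of_ne (not_lt.1 h2) hm')] at h
    exact (Prod.mk.inj (congrArg Subtype.val h)).1

omit [NeZero L] [NeZero P] in
/-- A direction pair containing `i` is `stdDir` of its other direction. [folklore] -/
theorem stdDir_otherDir_eq (p : Plaq (TiltedSite d i j (2 * P + 1) (2 * P + 1) L) d) (hp : p.2.1.1 = i ∨ p.2.1.2 = i) :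
    stdDir q i (otherDir i p) = p.2 := by
  rw [← mkDirPair_otherDir p hp]
  unfold stdDir mkDirPair
  by_cases h : i < otherDir i p
  · rw [dif_pos h, dif_pos h]
  · rw [dif_neg h, dif_neg h, dif_pos (lt_of_le_of_ne (not_lt.1 h) (otherDir_ne hp))]

/-- **The STANDING plaquette on the link `ℓ = (z, m)`**: base `z`, directions `{i, m}` (it connects
the layer of `z` to the next layer up). [folklore] -/
def stand (ℓ : Link (TiltedSite d i j (2 * P + 1) (2 * P + 1) L) d) : Plaq (TiltedSite d i j (2 * P + 1) (2 * P + 1) L) d :=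
  (ℓ.1, stdDir q i ℓ.2)

/-- **The HANGING plaquette under the link `ℓ = (w, m)`**: base `w - e_i`, directions `{i, m}`. [folklore] -/
def hang (ℓ : Link (TiltedSite d i j (2 * P + 1) (2 * P + 1) L) d) : Plaq (TiltedSite d i j (2 * P + 1) (2 * P + 1) L) d :=
  (ℓ.1 - tiltedUnit d i j (2 * P + 1) (2 * P + 1) L i, stdDir q i ℓ.2)

omit [NeZero L] [NeZero P] in
/-- The links of a plaquette `(x; {i, m})`, in either order of the pair. [folklore] -/
theorem hasLink_stdDir_iff (x : TiltedSite d i j (2 * P + 1) (2 * P + 1) L) {m : Fin d} (hm : m ≠ i)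
    (ℓ : Link (TiltedSite d i j (2 * P + 1) (2 * P + 1) L) d) :
    PairExp.HasLink (tiltedUnit d i j (2 * P + 1) (2 * P + 1) L) (x, stdDir q i m) ℓ ↔
      ℓ = (x, i) ∨ ℓ = (x + tiltedUnit d i j (2 * P + 1) (2 * P + 1) L i, m) ∨
        ℓ = (x + tiltedUnit d i j (2 * P + 1) (2 * P + 1) L m, i) ∨ ℓ = (x, m) := by
  rw [PairExp.hasLink_iff]
  unfold stdDir
  by_cases h : i < m
  · rw [dif_pos h]
  · rw [dif_neg h, dif_pos (lt_of_le_of_ne (not_lt.1 h) hm)]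
    simp only
    tauto

omit [NeZero L] [NeZero P] in
/-- **The links of the standing plaquette** on `(z, m)`: `(z,i)`, `(z+e_i,m)`, `(z+e_m,i)`, `(z,m)`.
[folklore] -/
theorem hasLink_stand_iff {z : TiltedSite d i j (2 * P + 1) (2 * P + 1) L} {m : Fin d} (hm : m ≠ i)
    (ℓ : Link (TiltedSite d i j (2 * P + 1) (2 * P + 1) L) d) :
    PairExp.HasLink (tiltedUnit d i j (2 * P + 1) (2 * P + 1) L) (stand q (z, m)) ℓ ↔
      ℓ = (z, i) ∨ ℓ = (z + tiltedUnit d i j (2 * P + 1) (2 * P + 1) L i, m) ∨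
        ℓ = (z + tiltedUnit d i j (2 * P + 1) (2 * P + 1) L m, i) ∨ ℓ = (z, m) :=
  hasLink_stdDir_iff q z hm ℓ

omit [NeZero L] [NeZero P] in
/-- **The links of the hanging plaquette** under `(w, m)`: `(w-e_i,i)`, `(w,m)`, `(w-e_i+e_m,i)`,
`(w-e_i,m)`. [folklore] -/
theorem hasLink_hang_iff {w : TiltedSite d i j (2 * P + 1) (2 * P + 1) L} {m : Fin d} (hm : m ≠ i)
    (ℓ : Link (TiltedSite d i j (2 * P + 1) (2 * P + 1) L) d) :
    PairExp.HasLink (tiltedUnit d i j (2 * P + 1) (2 * P + 1) L) (hang q (w, m)) ℓ ↔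
      ℓ = (w - tiltedUnit d i j (2 * P + 1) (2 * P + 1) L i, i) ∨ ℓ = (w, m) ∨
        ℓ = (w - tiltedUnit d i j (2 * P + 1) (2 * P + 1) L i + tiltedUnit d i j (2 * P + 1) (2 * P + 1) L m, i) ∨
        ℓ = (w - tiltedUnit d i j (2 * P + 1) (2 * P + 1) L i, m) := by
  unfold hang
  rw [hasLink_stdDir_iff q _ hm ℓ, sub_add_cancel]

/-! ## The links of a transverse plaquette -/

omit [NeZero L] [NeZero P] in
/-- **The four links of a transverse plaquette `(x; q)` (`q₁, q₂ ≠ i`) lie in the layer of `x` and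
have directions `≠ i`.** [folklore] -/
theorem hasLink_transverse (hq1 : q.1.1 ≠ i) (hq2 : q.1.2 ≠ i) (x : TiltedSite d i j (2 * P + 1) (2 * P + 1) L)
    {ℓ : Link (TiltedSite d i j (2 * P + 1) (2 * P + 1) L) d}
    (h : PairExp.HasLink (tiltedUnit d i j (2 * P + 1) (2 * P + 1) L) (x, q) ℓ) :
    axisCoord d L (2 * P + 1) ℓ.1 = axisCoord d L (2 * P + 1) x ∧ ℓ.2 ≠ i := by
  rw [PairExp.hasLink_iff] at h
  rcases h with rfl | rfl | rfl | rfl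
  · exact ⟨rfl, hq1⟩
  · exact ⟨axisCoord_add_of_ne x hq1, hq2⟩
  · exact ⟨axisCoord_add_of_ne x hq2, hq1⟩
  · exact ⟨rfl, hq2⟩

omit [NeZero L] [NeZero P] in
/-- Two plaquettes sharing no layer share no link: if every link of `p` is based in the layer `a` and
every link of `p'` in the layer `b ≠ a`, then no link of `p'` is a link of `p`. Transverse version:
`(x; q)` and `(x'; q)` with `x_i(x) ≠ x_i(x')`. [folklore] -/
theorem not_hasLink_transverse_of_axisCoord_ne (hq1 : q.1.1 ≠ i) (hq2 : q.1.2 ≠ i)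
    {x x' : TiltedSite d i j (2 * P + 1) (2 * P + 1) L} (hxx' : axisCoord d L (2 * P + 1) x ≠ axisCoord d L (2 * P + 1) x')
    {ℓ : Link (TiltedSite d i j (2 * P + 1) (2 * P + 1) L) d}
    (h : PairExp.HasLink (tiltedUnit d i j (2 * P + 1) (2 * P + 1) L) (x, q) ℓ) :
    ¬ PairExp.HasLink (tiltedUnit d i j (2 * P + 1) (2 * P + 1) L) (x', q) ℓ := fun h' =>
  hxx' ((hasLink_transverse q hq1 hq2 x h).1.symm.trans (hasLink_transverse q hq1 hq2 x' h').1)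

/-! ## Uniqueness of the rest plaquette through a link of the layers `P` and `P + 2` -/

omit [NeZero L] in
/-- ★ **A rest plaquette containing a transverse link of the layer `P` is its standing plaquette.**
[folklore] -/
theorem eq_stand_of_isRest (hP : 2 ≤ P) {p : Plaq (TiltedSite d i j (2 * P + 1) (2 * P + 1) L) d} (hp : IsRestL (P := P) p)
    {z : TiltedSite d i j (2 * P + 1) (2 * P + 1) L} {m : Fin d} (hm : m ≠ i)
    (hz : (axisCoord d L (2 * P + 1) z).val = P)
    (hℓ : PairExp.HasLink (tiltedUnit d i j (2 * P + 1) (2 * P + 1) L) p (z, m)) : p = stand q (z, m) := by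
  have hlay : ∀ x : TiltedSite d i j (2 * P + 1) (2 * P + 1) L, z = x + tiltedUnit d i j (2 * P + 1) (2 * P + 1) L i →
      (axisCoord d L (2 * P + 1) x).val = P - 1 := by
    intro x hx
    have h0 : (axisCoord d L (2 * P + 1) z).val ≠ 0 := by rw [hz]; omega
    have h1 := val_axisCoord_sub_self z h0
    rw [hx, add_sub_cancel_right] at h1
    rw [hx] at hz
    omega
  rcases hp with ⟨hdir, hbase⟩ | ⟨hdir, hbase⟩
  · -- longitudinal rest plaquette, base layer `0`, `P` or `P + 1`
    rw [PairExp.hasLink_iff] at hℓ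
    rcases hdir with hk | hl
    · -- `k = i`
      rcases hℓ with h | h | h | h
      · exact absurd ((congrArg Prod.snd h).trans hk) hm
      · -- `(z, m) = (x + e_i, l)`: base layer `P - 2`, not a rest layer
        have hx := hlay p.1 (by have h' := (Prod.mk.inj h).1; rw [hk] at h'; exact h')
        omega
      · exact absurd ((congrArg Prod.snd h).trans hk) hm
      · -- `(z, m) = (x, l)`: the standing plaquette
        have h1 : z = p.1 := congrArg Prod.fst h
        have h2 : m = p.2.1.2 := congrArg Prod.snd h
        have hod : otherDir i p = m := by unfold otherDir; rw [if_pos hk, h2]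
        unfold stand
        rw [h1, ← hod, stdDir_otherDir_eq q p (Or.inl hk)]
    · -- `l = i`
      rcases hℓ with h | h | h | h
      · have h1 : z = p.1 := congrArg Prod.fst h
        have h2 : m = p.2.1.1 := congrArg Prod.snd h
        have hki : p.2.1.1 ≠ i := fun h' => (ne_of_lt p.2.2) (h'.trans hl.symm)
        have hod : otherDir i p = m := by unfold otherDir; rw [if_neg hki, h2]
        unfold stand
        rw [h1, ← hod, stdDir_otherDir_eq q p (Or.inr hl)]
      · exact absurd ((congrArg Prod.snd h).trans hl) hm
      · have hx := hlay p.1 (by have h' := (Prod.mk.inj h).1; rw [hl] at h'; exact h')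
        omega
      · exact absurd ((congrArg Prod.snd h).trans hl) hm
  · -- transverse rest plaquette of the free layer `P + 1`: its links are not in the layer `P`
    exfalso
    rw [not_or] at hdir
    have h := (hasLink_transverse p.2 (Ne.symm (Ne.symm hdir.1)) hdir.2 p.1 (ℓ := (z, m)) hℓ).1
    simp only at h
    rw [h] at hz
    omega

omit [NeZero L] in
/-- ★ **A rest plaquette containing a transverse link of the layer `P + 2` is its hanging plaquette.**
[folklore] -/
theorem eq_hang_of_isRest (hP : 2 ≤ P) {p : Plaq (TiltedSite d i j (2 * P + 1) (2 * P + 1) L) d} (hp : IsRestL (P := P) p)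
    {w : TiltedSite d i j (2 * P + 1) (2 * P + 1) L} {m : Fin d} (hm : m ≠ i)
    (hw : (axisCoord d L (2 * P + 1) w).val = P + 2)
    (hℓ : PairExp.HasLink (tiltedUnit d i j (2 * P + 1) (2 * P + 1) L) p (w, m)) : p = hang q (w, m) := by
  have hlay : ∀ x : TiltedSite d i j (2 * P + 1) (2 * P + 1) L, w = x + tiltedUnit d i j (2 * P + 1) (2 * P + 1) L i →
      (axisCoord d L (2 * P + 1) x).val = P + 1 := by
    intro x hx
    have h0 : (axisCoord d L (2 * P + 1) w).val ≠ 0 := by rw [hw]; omega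
    have h1 := val_axisCoord_sub_self w h0
    rw [hx, add_sub_cancel_right] at h1
    rw [hx] at hw
    omega
  rcases hp with ⟨hdir, hbase⟩ | ⟨hdir, hbase⟩
  · rw [PairExp.hasLink_iff] at hℓ
    rcases hdir with hk | hl
    · rcases hℓ with h | h | h | h
      · exact absurd ((congrArg Prod.snd h).trans hk) hm
      · -- `(w, m) = (x + e_i, l)`: the hanging plaquette
        have h1 : w = p.1 + tiltedUnit d i j (2 * P + 1) (2 * P + 1) L i := by
          have h' := (Prod.mk.inj h).1; rw [hk] at h'; exact h'
        have h2 : m = p.2.1.2 := congrArg Prod.snd h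
        have hod : otherDir i p = m := by unfold otherDir; rw [if_pos hk, h2]
        unfold hang
        rw [h1, add_sub_cancel_right, ← hod, stdDir_otherDir_eq q p (Or.inl hk)]
      · exact absurd ((congrArg Prod.snd h).trans hk) hm
      · -- `(w, m) = (x, l)`: base layer `P + 2`, not a rest layer
        have h1 : w = p.1 := congrArg Prod.fst h
        rw [h1] at hw
        omega
    · rcases hℓ with h | h | h | h
      · have h1 : w = p.1 := congrArg Prod.fst h
        rw [h1] at hw
        omega
      · exact absurd ((congrArg Prod.snd h).trans hl) hm
      · have h1 : w = p.1 + tiltedUnit d i j (2 * P + 1) (2 * P + 1) L i := by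
          have h' := (Prod.mk.inj h).1; rw [hl] at h'; exact h'
        have h2 : m = p.2.1.1 := congrArg Prod.snd h
        have hki : p.2.1.1 ≠ i := fun h' => (ne_of_lt p.2.2) (h'.trans hl.symm)
        have hod : otherDir i p = m := by unfold otherDir; rw [if_neg hki, h2]
        unfold hang
        rw [h1, add_sub_cancel_right, ← hod, stdDir_otherDir_eq q p (Or.inr hl)]
      · exact absurd ((congrArg Prod.snd h).trans hl) hm
  · exfalso
    rw [not_or] at hdir
    have h := (hasLink_transverse p.2 (Ne.symm (Ne.symm hdir.1)) hdir.2 p.1 (ℓ := (w, m)) hℓ).1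
    simp only at h
    rw [h] at hw
    omega

/-! ## Injectivity -/

omit [NeZero L] [NeZero P] in
/-- `stand` is injective on links of direction `≠ i`. [folklore] -/
theorem stand_injective {ℓ ℓ' : Link (TiltedSite d i j (2 * P + 1) (2 * P + 1) L) d} (hm : ℓ.2 ≠ i) (hm' : ℓ'.2 ≠ i)
    (h : stand q ℓ = stand q ℓ') : ℓ = ℓ' := by
  unfold stand at h
  obtain ⟨h1, h2⟩ := Prod.mk.inj h
  exact Prod.ext h1 (stdDir_injective q hm hm' h2)

omit [NeZero L] [NeZero P] in
/-- `hang` is injective on links of direction `≠ i`. [folklore] -/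
theorem hang_injective {ℓ ℓ' : Link (TiltedSite d i j (2 * P + 1) (2 * P + 1) L) d} (hm : ℓ.2 ≠ i) (hm' : ℓ'.2 ≠ i)
    (h : hang q ℓ = hang q ℓ') : ℓ = ℓ' := by
  unfold hang at h
  obtain ⟨h1, h2⟩ := Prod.mk.inj h
  exact Prod.ext (sub_left_injective h1) (stdDir_injective q hm hm' h2)

omit [NeZero L] in
/-- A standing plaquette on a layer-`P` link is not a hanging plaquette under a layer-`(P+2)` link
(base layers `P ≠ P + 1`). [folklore] -/
theorem stand_ne_hang {ℓ ℓ' : Link (TiltedSite d i j (2 * P + 1) (2 * P + 1) L) d}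
    (hz : (axisCoord d L (2 * P + 1) ℓ.1).val = P) (hw : (axisCoord d L (2 * P + 1) ℓ'.1).val = P + 2) :
    stand q ℓ ≠ hang q ℓ' := by
  intro h
  unfold stand hang at h
  have h1 : ℓ.1 = ℓ'.1 - tiltedUnit d i j (2 * P + 1) (2 * P + 1) L i := (Prod.mk.inj h).1
  have h2 := val_axisCoord_sub_self ℓ'.1 (by rw [hw]; omega)
  rw [← h1, hz, hw] at h2
  omega

end RedLink

end TiltedRP

end Summit.QuantumFields.GaugeBoot

end
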